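import Mathlib

/-!
# S1a helper — UNIT DESCENT and the torus-weight (Rees) chart lemmas M8 [OURS · L1 W4.5c · idea-2 g14/g15 · card M]

NOT a statement of the manuscript; counted 0 (`--supports stmt-ResolutionOfSingularities-17941 --as helper`).
Role: first helpers of the producer stub `stub_localGame(T)` of the S1a lines `s1a-logminvertex` (L) /
`s1a-tamebr` (B) (plan-1 LANDABLE QUEUE 2026-08-27T19:39:06Z, item H2). Sources of record: HOME
`L/res-L1-w45c-idea-2/cardM_g14/UnitDescent.lean` 20ad122022f11156 and `cardM_g14/ReesChartM8.lean` d5dca1faecf17b41.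
AI-level work, weaker than expert review.

## Contents

§1 Unit descent for linear equations over a Noetherian local base: approximate (formal) UNIT solutions of an
`R`-linear equation `T ψ = 0` on a finite `R`-algebra `S`, `R` Noetherian local, descend to an honest unit
solution (`unitDescent`, Artin–Rees on `range T ⊆ S`; units detected modulo `𝔪_R S ⊆ Jac S`). Applied to
`T = σ − u·` (`σ` an `R`-algebra endomorphism of `S = 𝒪_{V,z}`, `R = 𝒪_{V/G,ȳ}`, `u` a Zariski unit cocycle
ratio: `unitDescent_semiInvariant`) it turns a FORMAL multiplicative frame into a ZARISKI one — the (α)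
re-basing step of the Rees-chart calculus.

§2 Torus-weight charts (M8). Under the pin `S1.LocallyDiagonalRootRegular` / `S1.LocallyTameRootRegular` the
weighted blow-up `Bl_{w*} 𝔸ⁿ` of a σ̃-admissible weight is covered by σ̃- and 𝔾ₘ-stable affine charts
`Spec (B_{N})₀` of the extended Rees algebra `B = k[x̄ᵢ := xᵢ t^{-wᵢ}, t]` (a polynomial ring, ℤ-graded, on which
`G` acts by graded automorphisms); the quotient chart of `Y = V/G` is `Spec ((B₀)^G) = Spec ((B^G)₀)`, so the
exit analysis is the frame calculus on the REGULAR ring `B` followed by taking degree 0. Typed and proved: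
`gradeBy_eq_supported` / `gradeBy_eq_span_single` (the degree-`i` part of a monoid algebra graded by a degree
map is spanned by the monomials of degree `i`), `mker_fg_of_fg` (Gordan-type, via Dickson: the kernel of an
additive character on a finitely generated commutative monoid with cancellative values is finitely generated),
`fixed_inter_subring` (`(B₀)^G = (B^G)₀`).
-/

set_option linter.dupNamespace false

namespace Summit.ResolutionOfSingularities.ResolutionOfSingularities.Theorems.WildQuotientResolution.S1.UnitDescent

/-! ## §1 Unit descent -/

section UnitDescent


open IsLocalRing

variable {R S : Type*} [CommRing R] [IsLocalRing R] [CommRing S] [Algebra R S]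

/-- In a finite algebra `S` over a local ring `R`, the extension of the maximal ideal of `R` lies in the
Jacobson radical of `S` (every maximal ideal of `S` contracts to the maximal ideal of `R`). -/
theorem map_maximalIdeal_le_jacobson_bot [Module.Finite R S] :
    (maximalIdeal R).map (algebraMap R S) ≤ (⊥ : Ideal S).jacobson := by
  refine le_sInf fun J hJ => ?_
  haveI : J.IsMaximal := hJ.2
  rw [Ideal.map_le_iff_le_comap]
  haveI : (J.comap (algebraMap R S)).IsMaximal := Ideal.isMaximal_comap_of_isIntegral_of_isMaximal J
  exact le_of_eq (eq_maximalIdeal inferInstance).symm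

/-- A unit plus an element of `𝔪_R S` is a unit. -/
theorem isUnit_of_isUnit_sub_mem [Module.Finite R S] {ψ η : S} (hψ : IsUnit ψ)
    (hη : η ∈ (maximalIdeal R).map (algebraMap R S)) : IsUnit (ψ - η) := by
  obtain ⟨v, rfl⟩ := hψ
  have hr : IsUnit (↑v⁻¹ * (↑v - η)) := by
    apply Ideal.isUnit_of_sub_one_mem_jacobson_bot
    have : (↑v⁻¹ : S) * (↑v - η) - 1 = -(↑v⁻¹ * η) := by
      rw [mul_sub, Units.inv_mul]; ring
    rw [this]
    exact neg_mem (map_maximalIdeal_le_jacobson_bot (Ideal.mul_mem_left _ _ hη))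
  simpa using (Units.isUnit v).mul hr

/-- **Unit descent (linear Artin approximation + units).** `R` Noetherian local, `S` a finite
`R`-algebra, `T : S →ₗ[R] S`. If for every `k` the equation `T ψ = 0` has a UNIT solution modulo
`𝔪_R^k S`, then it has a unit solution. (Artin–Rees on `range T ⊆ S`; units are detected modulo
`𝔪_R S ⊆ Jac S`.) [OURS · L1 W4.5c] -/
theorem unitDescent [IsNoetherianRing R] [Module.Finite R S] (T : S →ₗ[R] S)
    (h : ∀ k : ℕ, ∃ ψ : S, IsUnit ψ ∧ T ψ ∈ (maximalIdeal R) ^ k • (⊤ : Submodule R S)) :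
    ∃ ψ : S, IsUnit ψ ∧ T ψ = 0 := by
  obtain ⟨k, hk⟩ := Ideal.exists_pow_inf_eq_pow_smul (maximalIdeal R) (LinearMap.range T)
  obtain ⟨ψ, hψu, hψ⟩ := h (k + 1)
  have hmem : T ψ ∈ (maximalIdeal R) ^ (k + 1) • (⊤ : Submodule R S) ⊓ LinearMap.range T :=
    ⟨hψ, LinearMap.mem_range_self T ψ⟩
  rw [hk (k + 1) (Nat.le_succ k), Nat.add_sub_cancel_left, pow_one] at hmem
  -- `𝔪 • (…) ⊆ 𝔪 • range T = T (𝔪 • ⊤)`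
  have hle : (maximalIdeal R) • ((maximalIdeal R) ^ k • (⊤ : Submodule R S) ⊓ LinearMap.range T) ≤
      Submodule.map T ((maximalIdeal R) • (⊤ : Submodule R S)) := by
    rw [Submodule.map_smul'', Submodule.map_top]
    exact smul_mono_right _ inf_le_right
  obtain ⟨η, hη, hTη⟩ := hle hmem
  refine ⟨ψ - η, ?_, by rw [map_sub, hTη, sub_self]⟩
  have hη' : η ∈ (maximalIdeal R).map (algebraMap R S) := by
    have := (Ideal.smul_top_eq_map (maximalIdeal R) (R := R) (S := S)) ▸ hη
    simpa using this
  exact isUnit_of_isUnit_sub_mem hψu hη'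

/-- The form used by the EXIT-chart producer: `σ` an `R`-algebra endomorphism of `S`, `u ∈ S`; if
`σ ψ = u ψ` has unit solutions modulo every `𝔪_R^k S` (e.g. it has a unit solution in the completion),
it has a unit solution in `S`. [OURS · L1 W4.5c] -/
theorem unitDescent_semiInvariant [IsNoetherianRing R] [Module.Finite R S] (σ : S →ₐ[R] S) (u : S)
    (h : ∀ k : ℕ, ∃ ψ : S, IsUnit ψ ∧ σ ψ - u * ψ ∈ (maximalIdeal R) ^ k • (⊤ : Submodule R S)) :
    ∃ ψ : S, IsUnit ψ ∧ σ ψ = u * ψ := by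
  obtain ⟨ψ, hψ, h0⟩ := unitDescent (σ.toLinearMap - LinearMap.mulLeft R u) (by simpa using h)
  exact ⟨ψ, hψ, sub_eq_zero.mp (by simpa using h0)⟩

end UnitDescent

/-! ## §2 Torus-weight (Rees) charts: gradings of monoid algebras, Gordan, degree-zero invariants -/


section Grading

variable (R : Type*) [CommSemiring R] {M ι : Type*} (f : M → ι) (i : ι)

open AddMonoidAlgebra in
/-- The degree-`i` piece of `R[M]` for the grading by `f` is the submodule of elements supported
on `f ⁻¹' {i}`. -/
theorem gradeBy_eq_supported :
    AddMonoidAlgebra.gradeBy R f i = AddMonoidAlgebra.supported R R (f ⁻¹' {i}) :=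
  Submodule.ext fun _ => Iff.rfl

open AddMonoidAlgebra in
/-- The degree-`i` piece is spanned by the monomials of degree `i`. -/
theorem gradeBy_eq_span_single :
    AddMonoidAlgebra.gradeBy R f i =
      Submodule.span R ((fun m ↦ AddMonoidAlgebra.single m (1 : R)) '' (f ⁻¹' {i})) := by
  rw [gradeBy_eq_supported, AddMonoidAlgebra.supported_eq_span_single]

end Grading

section Gordan

variable {M N : Type*} [AddCommMonoid M] [AddCommMonoid N] [IsCancelAdd N]

/-- Gordan-type finiteness (via Dickson's lemma in Mathlib): the kernel of an additive
homomorphism from a finitely generated commutative monoid to a cancellative one is a finitely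
generated submonoid.  Used for: the degree-0 part of a toric chart monoid graded by a torus
character is again a finitely generated monoid. -/
theorem mker_fg_of_fg [h : AddMonoid.FG M] (χ : M →+ N) : (AddMonoidHom.mker χ).FG := by
  classical
  obtain ⟨S, hS⟩ := h.fg_top
  -- the canonical surjection from the free commutative monoid on `S`
  let φ : (S →₀ ℕ) →+ M := Finsupp.liftAddHom fun s : S => multiplesHom M (s : M)
  have hφ1 : ∀ s : S, φ (Finsupp.single s 1) = (s : M) := by
    intro s
    simp [φ]
  have hsurj : Function.Surjective φ := by
    rw [← AddMonoidHom.mrange_eq_top, eq_top_iff, ← hS, AddSubmonoid.closure_le]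
    intro s hs
    exact ⟨Finsupp.single ⟨s, hs⟩ 1, hφ1 ⟨s, hs⟩⟩
  have hfg : (AddMonoidHom.eqLocusM (χ.comp φ) 0).FG := AddSubmonoid.fg_eqLocusM _ _
  have heq : AddMonoidHom.mker χ = (AddMonoidHom.eqLocusM (χ.comp φ) 0).map φ := by
    ext m
    constructor
    · intro hm
      obtain ⟨x, rfl⟩ := hsurj m
      refine ⟨x, ?_, rfl⟩
      simp only [AddMonoidHom.mem_mker] at hm
      simp [AddMonoidHom.eqLocusM, hm]
    · rintro ⟨x, hx, rfl⟩
      simp only [AddMonoidHom.eqLocusM, AddMonoidHom.coe_comp, Function.comp_apply,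
        AddMonoidHom.zero_apply] at hx
      simpa [AddMonoidHom.mem_mker] using hx
  rw [heq]
  exact hfg.map φ

end Gordan

section DegreeZeroInvariants

variable {B : Type*} [CommRing B] {G : Type*} [Group G] [MulSemiringAction G B]

/-- `(B₀)^G = (B^G)₀`: for a group acting on a ring and ANY subring `B₀` (e.g. the degree-0 part
of a grading the action respects), the invariants of `B₀` are the invariants of `B` lying in `B₀`.
Trivial, recorded because it is the sentence that moves the exit analysis from the singular
weighted model to the regular Rees chart. -/
theorem fixed_inter_subring (B₀ : Subring B) :
    {b : B | b ∈ B₀ ∧ ∀ g : G, g • b = b} = {b : B | ∀ g : G, g • b = b} ∩ (B₀ : Set B) := by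
  ext b
  simp only [Set.mem_setOf_eq, Set.mem_inter_iff, SetLike.mem_coe]
  tauto

end DegreeZeroInvariants

end Summit.ResolutionOfSingularities.ResolutionOfSingularities.Theorems.WildQuotientResolution.S1.UnitDescent
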